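import Literature.AlgebraicGeometry.HodgeTheory.AffineSpaceBundleCohomology
import HarnessLib

/-!
# Zariski-local affine-space products are stable under base change along any `ℂ`-morphism

Family `hodge`, layer `Literature/AlgebraicGeometry/HodgeTheory` (theorems + two auxiliary
definitions; no named fact; net debt 0). Companion to `AffineSpaceBundleCohomology` (§1 there: the
notion `IsZariskiLocallyAffineProduct π r` — a `ℂ`-morphism `π : Y ⟶ X` which is, Zariski-locally on
`X`, the projection `V × 𝔸ʳ → V`, the shape of a torsor under a vector bundle, e.g. Jouanolou's device)
and to `JouanolouDeviceCohomology` (§1 there: stability under extension of scalars `τ : ℂ →+* ℂ`).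
This file proves stability under base change along an ARBITRARY `ℂ`-morphism `g : Y' ⟶ X`:

* `fibreProd g π` (§1) — the fibre product `Y' ×_X Y` as a `ℂ`-scheme (Mathlib's `pullback g.left
  π.left` with structure morphism through `Y'`), with projections `fibreProd.fst : Y' ×_X Y ⟶ Y'`,
  `fibreProd.snd : Y' ×_X Y ⟶ Y` and the commuting square `fst ≫ g = snd ≫ π`;
* `IsZariskiLocallyAffineProduct.fibreProd_fst` (§2, PROVED) — if `π` is Zariski-locally on `X` a
  product with `𝔸ʳ`, then so is its base change `Y' ×_X Y ⟶ Y'` (Hartshorne II.3 Thm. 3.3: fibre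
  products exist and base change is transitive, `(Y' ×_X V) ×_V (V × 𝔸ʳ) ≅ (Y' ×_X V) × 𝔸ʳ`; a chart
  `(j : V ↪ X, W ≅ V × 𝔸ʳ)` at `g(y')` pulls back to the chart `(Y' ×_X V ↪ Y', (Y' ×_X Y) ×_Y W ≅
  (Y' ×_X V) × 𝔸ʳ)` at `y'`).

Use (lane `lit-hodgefound`, row Q19 = staging S3a of the V-B2′ programme): for a smooth projective `X`
with Jouanolou chart `π₀ : Y₀ ⟶ X` and any `ℂ`-morphism `h : Y' ⟶ X` from a smooth affine `Y'`, the
projection `Y' ×_X Y₀ ⟶ Y'` is again an affine-space bundle, hence bijective on `Hᵏ(–(ℂ); ℂ)`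
(`bijective_complexBetti_map_of_isZariskiLocallyAffineProduct`), which transports naturality of a
conjugation datum from affine to projective varieties (`ChartConjugationCanonicalOfAffine`).

## References

* R. Hartshorne, *Algebraic Geometry* (1977), II.3 Thm. 3.3 and the remarks following it (base
  extension; transitivity of fibre products). [Hartshorne1977]
* J.-P. Jouanolou, *Une suite exacte de Mayer–Vietoris en K-théorie algébrique*, LNM 341 (1973),
  Lemme 1.5. [Jouanolou1973]
-/

noncomputable section

open CategoryTheory CategoryTheory.Limits AlgebraicGeometry MonoidalCategory
open Literature.NumberTheory.Transcendental
open Literature.AlgebraicGeometry.Motives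

namespace Literature.AlgebraicGeometry.HodgeTheory

section HodgeTheory

/-! ### §1 The fibre product `Y' ×_X Y` of two `ℂ`-schemes over a third -/

section FibreProd

variable {Y X Y' : SchemeOver ℂ} (g : Y' ⟶ X) (π : Y ⟶ X)

/-- The **fibre product** `Y' ×_X Y` of `g : Y' ⟶ X` and `π : Y ⟶ X`, as a `ℂ`-scheme with structure
morphism `Y' ×_X Y → Y' → Spec ℂ` (underlying scheme: Mathlib's `pullback g.left π.left`).
[cite: Hartshorne1977, II.3 Thm. 3.3] -/
def fibreProd : SchemeOver ℂ :=
  Over.mk (pullback.fst g.left π.left ≫ Y'.hom)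

/-- The underlying scheme of `Y' ×_X Y` is Mathlib's `pullback g.left π.left` (definitional).
[cite: Hartshorne1977, II.3 Thm. 3.3] -/
@[simp]
theorem fibreProd_left : (fibreProd g π).left = pullback g.left π.left := rfl

/-- The structure morphism of `Y' ×_X Y` factors through `Y'` (definitional).
[cite: Hartshorne1977, II.3 Thm. 3.3] -/
@[simp]
theorem fibreProd_hom : (fibreProd g π).hom = pullback.fst g.left π.left ≫ Y'.hom := rfl

/-- The first projection `Y' ×_X Y ⟶ Y'` over `ℂ`. [cite: Hartshorne1977, II.3 Thm. 3.3] -/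
def fibreProd.fst : fibreProd g π ⟶ Y' :=
  Over.homMk (pullback.fst g.left π.left) rfl

/-- The second projection `Y' ×_X Y ⟶ Y` over `ℂ`. [cite: Hartshorne1977, II.3 Thm. 3.3] -/
def fibreProd.snd : fibreProd g π ⟶ Y :=
  Over.homMk (pullback.snd g.left π.left) (by
    change pullback.snd g.left π.left ≫ Y.hom = pullback.fst g.left π.left ≫ Y'.hom
    rw [← Over.w π, ← Category.assoc, ← pullback.condition, Category.assoc, Over.w g])

/-- Underlying scheme morphism of the first projection (definitional). [cite: Hartshorne1977, II.3 Thm. 3.3] -/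
@[simp]
theorem fibreProd.fst_left : (fibreProd.fst g π).left = pullback.fst g.left π.left := rfl

/-- Underlying scheme morphism of the second projection (definitional). [cite: Hartshorne1977, II.3 Thm. 3.3] -/
@[simp]
theorem fibreProd.snd_left : (fibreProd.snd g π).left = pullback.snd g.left π.left := rfl

/-- The fibre-product square commutes: `fst ≫ g = snd ≫ π`. [cite: Hartshorne1977, II.3 Thm. 3.3] -/
@[reassoc]
theorem fibreProd.condition : fibreProd.fst g π ≫ g = fibreProd.snd g π ≫ π :=
  Over.OverMorphism.ext pullback.condition

/-- The fibre-product square is cartesian on underlying schemes. [cite: Hartshorne1977, II.3 Thm. 3.3] -/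
theorem fibreProd.isPullback_left :
    IsPullback (fibreProd.fst g π).left (fibreProd.snd g π).left g.left π.left :=
  IsPullback.of_hasPullback g.left π.left

/-- The first projection is an open immersion when `π` is. [cite: Hartshorne1977, II.3 Thm. 3.3] -/
instance fibreProd.isOpenImmersion_fst_left [IsOpenImmersion π.left] :
    IsOpenImmersion (fibreProd.fst g π).left :=
  MorphismProperty.pullback_fst (P := @IsOpenImmersion) g.left π.left ‹_›

/-- The image of the first projection `Y' ×_X Y ⟶ Y'` is the preimage under `g` of the image of `π`.
[cite: Hartshorne1977, II.3 Thm. 3.3] -/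
theorem fibreProd.range_fst_left_base :
    Set.range (fibreProd.fst g π).left.base = g.left.base ⁻¹' Set.range π.left.base :=
  Scheme.Pullback.range_fst g.left π.left

/-- On points, `g (fst w) = π (snd w)` for `w ∈ Y' ×_X Y`. [cite: Hartshorne1977, II.3 Thm. 3.3] -/
theorem fibreProd.base_fst_eq_base_snd (w : ↥(fibreProd g π).left) :
    g.left.base ((fibreProd.fst g π).left.base w) = π.left.base ((fibreProd.snd g π).left.base w) := by
  change ((fibreProd.fst g π).left ≫ g.left).base w = ((fibreProd.snd g π).left ≫ π.left).base w
  rw [← Over.comp_left, ← Over.comp_left, fibreProd.condition]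

/-- `Y' ×_X Y` is affine when `Y'` is affine and `π` is an affine morphism (e.g. `Y` affine and `X`
separated over `ℂ`). [cite: Hartshorne1977, II.3 Thm. 3.3] -/
instance fibreProd.isAffine_left [IsAffine Y'.left] [IsAffineHom π.left] :
    IsAffine (fibreProd g π).left :=
  inferInstanceAs (IsAffine (pullback g.left π.left))

/-- The first projection `Y' ×_X Y ⟶ Y'` is smooth of relative dimension `r` when `π` is (base change).
[cite: Hartshorne1977, III Prop. 10.1 (b)] -/
instance fibreProd.smoothOfRelativeDimension_fst_left (r : ℕ) [SmoothOfRelativeDimension r π.left] :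
    SmoothOfRelativeDimension r (fibreProd.fst g π).left := by
  haveI := smoothOfRelativeDimension_isStableUnderBaseChange (n := r)
  exact MorphismProperty.pullback_fst (P := @SmoothOfRelativeDimension r) g.left π.left ‹_›

/-- `Y' ×_X Y → Spec ℂ` is smooth of relative dimension `r + m'` when `π` is smooth of relative
dimension `r` and `Y' → Spec ℂ` of relative dimension `m'`. [cite: Hartshorne1977, III Prop. 10.1 (c)] -/
theorem fibreProd.smoothOfRelativeDimension_hom (r m' : ℕ) [SmoothOfRelativeDimension r π.left]
    [SmoothOfRelativeDimension m' Y'.hom] :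
    SmoothOfRelativeDimension (r + m') (fibreProd g π).hom :=
  smoothOfRelativeDimension_comp r m' (fibreProd.fst g π).left Y'.hom

end FibreProd

/-! ### §2 Base change of a Zariski-local affine-space product -/

section BaseChange

variable {Y X Y' : SchemeOver ℂ} (g : Y' ⟶ X) {π : Y ⟶ X} {r : ℕ}

/-- The defining square of `V ⊗ 𝔸ʳ = V ×_ℂ 𝔸ʳ` is cartesian on underlying schemes (Mathlib:
`(V ⊗ A).left = pullback V.hom A.hom`). [cite: Hartshorne1977, II.3 Thm. 3.3] -/
theorem isPullback_tensorObj_left (V A : SchemeOver ℂ) :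
    IsPullback (CartesianMonoidalCategory.fst V A).left (CartesianMonoidalCategory.snd V A).left
      V.hom A.hom :=
  IsPullback.of_hasPullback V.hom A.hom

/-- **One chart pulls back to a chart.** Given a `ℂ`-morphism `j : V ⟶ X` and an open immersion
`ĩ : V ⊗ 𝔸ʳ ⟶ Y` with `pr₁ ≫ j = ĩ ≫ π`, the base change
`(Y' ×_X Y) ×_Y (V ⊗ 𝔸ʳ)` is isomorphic over `ℂ` to `(Y' ×_X V) ⊗ 𝔸ʳ`, compatibly with the
projections to `Y'` (transitivity of fibre products: both are `Y' ×_X (V ⊗ 𝔸ʳ)`).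
[cite: Hartshorne1977, II.3 Thm. 3.3] -/
theorem exists_chart_fibreProd {V : SchemeOver ℂ} (j : V ⟶ X)
    (ĩ : V ⊗ affineSpaceOver (Fin r) ℂ ⟶ Y)
    (hsq : CartesianMonoidalCategory.fst _ _ ≫ j = ĩ ≫ π) :
    ∃ e : fibreProd (fibreProd.snd g π) ĩ ≅ fibreProd g j ⊗ affineSpaceOver (Fin r) ℂ,
      e.hom ≫ CartesianMonoidalCategory.fst _ _ ≫ fibreProd.fst g j =
        fibreProd.fst (fibreProd.snd g π) ĩ ≫ fibreProd.fst g π := by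
  -- the square `pr₁ ≫ j = ĩ ≫ π` on underlying schemes
  have hsq' : (CartesianMonoidalCategory.fst V (affineSpaceOver (Fin r) ℂ)).left ≫ j.left =
      ĩ.left ≫ π.left := by
    rw [← Over.comp_left, hsq, Over.comp_left]
  -- `W' := (Y' ×_X Y) ×_Y (V ⊗ 𝔸ʳ)` is `Y' ×_X (V ⊗ 𝔸ʳ)`: paste the two defining squares
  have h1 : IsPullback (fibreProd.snd (fibreProd.snd g π) ĩ).left
      ((fibreProd.fst (fibreProd.snd g π) ĩ).left ≫ (fibreProd.fst g π).left)
      (ĩ.left ≫ π.left) g.left :=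
    (fibreProd.isPullback_left (fibreProd.snd g π) ĩ).flip.paste_vert (fibreProd.isPullback_left g π).flip
  -- the comparison map `W' → V' := Y' ×_X V`
  have hcomm : ((fibreProd.fst (fibreProd.snd g π) ĩ).left ≫ (fibreProd.fst g π).left) ≫ g.left =
      ((fibreProd.snd (fibreProd.snd g π) ĩ).left ≫
        (CartesianMonoidalCategory.fst V (affineSpaceOver (Fin r) ℂ)).left) ≫ j.left := by
    simpa only [Category.assoc, hsq'] using h1.w.symm
  obtain ⟨a, ha₁, ha₂⟩ : ∃ a : (fibreProd (fibreProd.snd g π) ĩ).left ⟶ (fibreProd g j).left,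
      a ≫ (fibreProd.fst g j).left =
          (fibreProd.fst (fibreProd.snd g π) ĩ).left ≫ (fibreProd.fst g π).left ∧
        a ≫ (fibreProd.snd g j).left =
          (fibreProd.snd (fibreProd.snd g π) ĩ).left ≫
            (CartesianMonoidalCategory.fst V (affineSpaceOver (Fin r) ℂ)).left :=
    ⟨pullback.lift _ _ hcomm, pullback.lift_fst _ _ _, pullback.lift_snd _ _ _⟩
  -- `W' = V' ×_V (V ⊗ 𝔸ʳ)`
  have h1' : IsPullback (fibreProd.snd (fibreProd.snd g π) ĩ).left (a ≫ (fibreProd.fst g j).left)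
      ((CartesianMonoidalCategory.fst V (affineSpaceOver (Fin r) ℂ)).left ≫ j.left) g.left := by
    rw [ha₁, hsq']; exact h1
  have h2 : IsPullback (fibreProd.snd (fibreProd.snd g π) ĩ).left a
      (CartesianMonoidalCategory.fst V (affineSpaceOver (Fin r) ℂ)).left (fibreProd.snd g j).left :=
    h1'.of_bot ha₂.symm (fibreProd.isPullback_left g j).flip
  -- `W' = V' ×_ℂ 𝔸ʳ`
  have h3 := h2.paste_horiz (isPullback_tensorObj_left V (affineSpaceOver (Fin r) ℂ)).flip
  have hV'hom : (fibreProd g j).hom = (fibreProd.snd g j).left ≫ V.hom := by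
    change pullback.fst g.left j.left ≫ Y'.hom = pullback.snd g.left j.left ≫ V.hom
    rw [← Over.w g, ← Category.assoc, pullback.condition, Category.assoc, Over.w j]
  have h4 : IsPullback a ((fibreProd.snd (fibreProd.snd g π) ĩ).left ≫
      (CartesianMonoidalCategory.snd V (affineSpaceOver (Fin r) ℂ)).left)
      (fibreProd g j).hom (affineSpaceOver (Fin r) ℂ).hom := by
    rw [hV'hom]; exact h3.flip
  -- the isomorphism of `ℂ`-schemes `W' ≅ V' ⊗ 𝔸ʳ` (two pullbacks of one cospan)
  let eL := h4.isoIsPullback _ _ (isPullback_tensorObj_left (fibreProd g j) (affineSpaceOver (Fin r) ℂ))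
  have heL : eL.hom ≫ (CartesianMonoidalCategory.fst (fibreProd g j) (affineSpaceOver (Fin r) ℂ)).left = a :=
    h4.isoIsPullback_hom_fst _ _ _
  refine ⟨Over.isoMk eL ?_, ?_⟩
  · change eL.hom ≫ (CartesianMonoidalCategory.fst (fibreProd g j) (affineSpaceOver (Fin r) ℂ)).left ≫
        (fibreProd g j).hom = (fibreProd (fibreProd.snd g π) ĩ).hom
    rw [← Category.assoc, heL]
    change a ≫ (fibreProd.fst g j).left ≫ Y'.hom =
      (fibreProd.fst (fibreProd.snd g π) ĩ).left ≫ (fibreProd.fst g π).left ≫ Y'.hom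
    rw [← Category.assoc, ha₁, Category.assoc]
  · ext
    change (eL.hom ≫ (CartesianMonoidalCategory.fst (fibreProd g j) (affineSpaceOver (Fin r) ℂ)).left) ≫
        (fibreProd.fst g j).left =
      (fibreProd.fst (fibreProd.snd g π) ĩ).left ≫ (fibreProd.fst g π).left
    rw [heL, ha₁]

/-- **Zariski-local affine-space products are stable under base change.** If `π : Y ⟶ X` is
Zariski-locally on `X` a product with `𝔸ʳ`, then so is the first projection `Y' ×_X Y ⟶ Y'` for every
`ℂ`-morphism `g : Y' ⟶ X`: the chart `(j : V ↪ X, i : W ↪ Y, e : W ≅ V × 𝔸ʳ)` at `g(y')` base-changes to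
the chart `(Y' ×_X V ↪ Y', (Y' ×_X Y) ×_Y (V × 𝔸ʳ) ↪ Y' ×_X Y, ≅ (Y' ×_X V) × 𝔸ʳ)` at `y'`
(`exists_chart_fibreProd`, after replacing `i` by the open immersion `e⁻¹ ≫ i : V × 𝔸ʳ ⟶ Y`).
[cite: Hartshorne1977, II.3 Thm. 3.3] -/
theorem IsZariskiLocallyAffineProduct.fibreProd_fst (h : IsZariskiLocallyAffineProduct π r) :
    IsZariskiLocallyAffineProduct (fibreProd.fst g π) r := by
  intro y'
  obtain ⟨V, W, j, i, hj, hi, e, hx, hsub, hsq⟩ := h (g.left.base y')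
  -- replace the chart source `W` by `V ⊗ 𝔸ʳ` itself, along `e`
  haveI : IsIso e.inv.left := Functor.map_isIso (Over.forget _) e.inv
  haveI hĩ : IsOpenImmersion (e.inv ≫ i).left := by
    rw [Over.comp_left]; infer_instance
  have hsq' : CartesianMonoidalCategory.fst _ _ ≫ j = (e.inv ≫ i) ≫ π := by
    rw [Category.assoc, ← hsq, e.inv_hom_id_assoc]
  have hrange : Set.range (e.inv ≫ i).left.base = Set.range i.left.base := by
    rw [Over.comp_left, Scheme.Hom.comp_base, TopCat.coe_comp, Set.range_comp,
      Set.range_eq_univ.mpr e.inv.left.surjective, Set.image_univ]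
  obtain ⟨e', he'⟩ := exists_chart_fibreProd g j (e.inv ≫ i) hsq'
  refine ⟨fibreProd g j, fibreProd (fibreProd.snd g π) (e.inv ≫ i), fibreProd.fst g j,
    fibreProd.fst (fibreProd.snd g π) (e.inv ≫ i), inferInstance, inferInstance, e', ?_, ?_, he'⟩
  · -- `y'` lies in `g⁻¹(j(V))`
    rw [fibreProd.range_fst_left_base]
    exact hx
  · -- `pr₁⁻¹(g⁻¹ j(V)) ⊆ pr₂⁻¹(i(W))`
    intro w hw
    rw [fibreProd.range_fst_left_base, hrange, Set.mem_preimage]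
    rw [Set.mem_preimage, fibreProd.range_fst_left_base, Set.mem_preimage,
      fibreProd.base_fst_eq_base_snd] at hw
    exact hsub hw

end BaseChange

end HodgeTheory

end Literature.AlgebraicGeometry.HodgeTheory

end
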